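import Summits.CriticalPhenomena.PercolationContinuityZ3.Theorems.PercNearOneGluingNoHeavyLowerTailQ7PsiSetObserver
import HarnessLib

/-!
# `NoHeavyLowerTail` (stmt-CriticalPhenomena-4575) — the three-cluster FACET inequality of the deficit polytope
# (the `Ψ ≡ 0` shadow of 'principal reduction')

Support file (`--supports stmt-CriticalPhenomena-4575`, closed), coupling seat `prim-cplus-coupling` (gen 15).  No
definitions, no named facts, no sorries; standard axioms.  Memo A5-COUPLING-gen15.md §3.

For three vertices `a, b, c` of a finite weighted graph and a monotone non-negative cluster function `F`,
`P(b↮c) · E F(C_a) ≥ [P(a↔b)·P(b↮c) − P(b↔c)·P(a↔c, a↮b)] · E F(C_b) + P(a↔c, a↮b) · E F(C_c)`,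
with equality for the principal up-sets `F = 1{b ∈ ·}` and `F = 1{b ∈ · ∨ c ∈ ·}`; for `P(a↔c, a↮b) = 0` it is Harris'
`E F(C_a) ≥ P(a↔b) E F(C_b)`.  Numerically (gen 15) these six inequalities (ordered triples) and the unit box are ALL facets of the
polytope `conv{(P(π(C_a)∈U₀), P(π(C_b)∈U₀), P(π(C_c)∈U₀)) : U₀ up-set of 2^{a,b,c}}`, i.e. of the region of marginal vectors
`(P(C_a∈U), P(C_b∈U), P(C_c∈U))` over ALL increasing cluster properties `U` — 'principal reduction at infinity'.
Proof: `E F(C_a) = ∫_{a↔b} F(C_b) + ∫_{a↮b} F(C_a)`, `E F(C_c) = ∫_{b↔c} F(C_b) + ∫_{b↮c} F(C_c)`; the `C_b`-terms are the z-free core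
`Q7Psi.setObs_cov_ge` (owner `b`, observer `{a}`, marker `c`; BHK Thm 1.5 + Harris), and `∫_{a↮b} F(C_a) ≥ ∫_{a↔c, a↮b} F(C_c)
≥ (P(a↔c,a↮b)/P(b↮c)) ∫_{c↮b} F(C_c)` by BHK Thm 1.3 for `C_c` given `{c ↮ b}`.

* `Q7Psi.deficitFacet` — the inequality above.
[cite: VandenbergHaggstromKahn2005, Thm. 1.3 (p. 6), Thm. 1.5 (p. 7)] [cite: KozmaNitzan2024, §5.1 (pp. 31–32)]
-/

namespace Summit.CriticalPhenomena.PercolationContinuityZ3.Theorems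

open MeasureTheory Set Literature.Probability.LatticeModels Literature.Probability.Percolation
open scoped Classical
open KNPreFKG

noncomputable section

namespace Q7Psi

universe u

variable {V : Type u} [Fintype V]

/-- **Deficit-polytope facet inequality.**  For vertices `a, b, c` with `b ≠ c` and a monotone non-negative cluster function `F`:
`(P(a↔b)·P(b↮c) − P(b↔c)·P(a↔c, a↮b)) · E F(C_b) + P(a↔c, a↮b) · E F(C_c) ≤ P(b↮c) · E F(C_a)`.
(z-free core `setObs_cov_ge` for `C_b` with observer `{a}` and marker `c`, plus BHK Thm 1.3 for `C_c` given `c ↮ b`.)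
[cite: VandenbergHaggstromKahn2005, Thm. 1.3 (p. 6), Thm. 1.5 (p. 7)] -/
theorem deficitFacet (w : Sym2 V → unitInterval) (a b c : V) (hbc : b ≠ c) (F : Set V → ℝ)
    (hF : ∀ S T : Set V, S ⊆ T → F S ≤ F T) (hF0 : ∀ S, 0 ≤ F S) :
    ((prodBernoulli w).real (openConn a b) * (prodBernoulli w).real {ω : BondConfig V | ¬ (openGraph ω).Reachable b c} -
          (prodBernoulli w).real (openConn b c) *
            (prodBernoulli w).real (openConn a c ∩ {ω : BondConfig V | ¬ (openGraph ω).Reachable a b})) *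
        (∫ ω, F (openCluster ω b) ∂(prodBernoulli w)) +
      (prodBernoulli w).real (openConn a c ∩ {ω : BondConfig V | ¬ (openGraph ω).Reachable a b}) *
        (∫ ω, F (openCluster ω c) ∂(prodBernoulli w)) ≤
      (prodBernoulli w).real {ω : BondConfig V | ¬ (openGraph ω).Reachable b c} *
        ∫ ω, F (openCluster ω a) ∂(prodBernoulli w) := by
  classical
  set μ := prodBernoulli w with hμ
  have hmeas : ∀ T : Set (BondConfig V), MeasurableSet T := fun _ => MeasurableSet.of_discrete
  -- notation
  set S : Set (BondConfig V) := {ω : BondConfig V | ¬ (openGraph ω).Reachable b c} with hS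
  set Q : Set (BondConfig V) := openConn a c ∩ {ω : BondConfig V | ¬ (openGraph ω).Reachable a b} with hQ
  set s : ℝ := μ.real S with hs
  set q : ℝ := μ.real Q with hq
  set pab : ℝ := μ.real (openConn a b) with hpab
  set pbc : ℝ := μ.real (openConn b c) with hpbc
  set A : ℝ := ∫ ω, F (openCluster ω a) ∂μ with hA
  set B : ℝ := ∫ ω, F (openCluster ω b) ∂μ with hB
  set Cc : ℝ := ∫ ω, F (openCluster ω c) ∂μ with hCc
  set Ba : ℝ := ∫ ω in openConn a b, F (openCluster ω b) ∂μ with hBa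
  set Bc : ℝ := ∫ ω in openConn b c, F (openCluster ω b) ∂μ with hBc
  set Ana : ℝ := ∫ ω in (openConn a b)ᶜ, F (openCluster ω a) ∂μ with hAna
  set Cnb : ℝ := ∫ ω in (openConn b c)ᶜ, F (openCluster ω c) ∂μ with hCnb
  have hs0 : 0 ≤ s := measureReal_nonneg
  have hq0 : 0 ≤ q := measureReal_nonneg
  -- (1) splits: `A = Ba + Ana`, `Cc = Bc + Cnb` (on `{a↔b}` resp. `{b↔c}` the clusters coincide)
  have hAsplit : A = Ba + Ana := by
    have e := integral_add_compl (hmeas (openConn a b)) (Integrable.of_finite : Integrable (fun ω => F (openCluster ω a)) μ)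
    have h1 : ∫ ω in openConn a b, F (openCluster ω a) ∂μ = Ba := by
      refine setIntegral_congr_fun (hmeas _) fun ω hω => ?_
      have h : (openGraph ω).Reachable a b := hω
      simp only [openCluster_eq_of_reachable h]
    rw [h1] at e
    linarith
  have hCsplit : Cc = Bc + Cnb := by
    have e := integral_add_compl (hmeas (openConn b c)) (Integrable.of_finite : Integrable (fun ω => F (openCluster ω c)) μ)
    have h1 : ∫ ω in openConn b c, F (openCluster ω c) ∂μ = Bc := by
      refine setIntegral_congr_fun (hmeas _) fun ω hω => ?_
      have h : (openGraph ω).Reachable b c := hω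
      simp only [openCluster_eq_of_reachable h]
    rw [h1] at e
    linarith
  -- (2) the z-free core for `C_b`, observer `{a}`, marker `c`:  `q (Bc − pbc B) ≤ s (Ba − pab B)`
  have hcore := setObs_cov_ge w b c ({a} : Set V) hbc F hF
  have hset1 : ({ω : BondConfig V | ¬ (openGraph ω).Reachable b c} ∩
      ({ω | ∀ n ∈ ({a} : Set V), ¬ (openGraph ω).Reachable b n} ∩
        {ω | ∃ n ∈ ({a} : Set V), (openGraph ω).Reachable c n})) = Q := by
    ext ω
    simp only [hQ, mem_inter_iff, mem_setOf_eq, mem_singleton_iff, forall_eq, exists_eq_left, openConn]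
    constructor
    · rintro ⟨_, hba, hca⟩
      exact ⟨hca.symm, fun hab => hba hab.symm⟩
    · rintro ⟨hac, hab⟩
      refine ⟨fun hbc' => hab ?_, fun hba => hab hba.symm, hac.symm⟩
      exact hac.trans hbc'.symm
  have hset2 : {ω : BondConfig V | ∃ n ∈ ({a} : Set V), (openGraph ω).Reachable b n} = openConn a b := by
    ext ω
    simp only [mem_setOf_eq, mem_singleton_iff, exists_eq_left, openConn]
    exact SimpleGraph.reachable_comm
  rw [hset1, hset2] at hcore
  -- hcore : q * (Bc - pbc * B) ≤ s * (Ba - pab * B)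
  -- (3) BHK Thm 1.3 for `C_c` given `{c ↮ b}` with the increasing pair (F, 1{a ∈ ·}):  `Cnb * q ≤ s * ∫_{Q} F(C_c)`
  have hDS : {ω : BondConfig V | ∀ x ∈ ({b} : Set V), ¬ (openGraph ω).Reachable c x} = (openConn b c)ᶜ := by
    ext ω
    simp only [mem_setOf_eq, mem_singleton_iff, forall_eq, mem_compl_iff, openConn]
    exact ⟨fun h h' => h h'.symm, fun h h' => h h'.symm⟩
  have hSS : S = (openConn b c)ᶜ := by
    ext ω; simp only [hS, mem_setOf_eq, mem_compl_iff, openConn]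
  have hcb : c ∉ ({b} : Set V) := fun h => hbc (mem_singleton_iff.1 h).symm
  set G1 : Set (Sym2 V) → ℝ := fun C => if a = c ∨ ∃ e ∈ C, a ∈ e then 1 else 0 with hG1
  have hG1m : Monotone G1 := by
    intro C C' hCC'
    simp only [hG1]
    by_cases h : a = c ∨ ∃ e ∈ C, a ∈ e
    · have h' : a = c ∨ ∃ e ∈ C', a ∈ e := h.imp id fun ⟨e, he, hae⟩ => ⟨e, hCC' he, hae⟩
      rw [if_pos h, if_pos h']
    · rw [if_neg h]; split_ifs <;> norm_num
  have hbhk := Literature.Probability.Percolation.BHK2006_clusterConditionalPositiveAssociation_holds V w c ({b} : Set V)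
    (fun C => F {v | v = c ∨ ∃ e ∈ C, v ∈ e}) G1 (monotone_clusterFun c F hF) hG1m hcb
  simp only [clusterFun_openEdgeCluster] at hbhk
  -- identify `G1 (C_c ω)` with the indicator of `{a ↔ c}` read as `openConn a c`
  have hG1ω : ∀ ω : BondConfig V, G1 (openEdgeCluster ω c) = (openConn a c : Set (BondConfig V)).indicator 1 ω := by
    intro ω
    by_cases h : ω ∈ openConn a c
    · have h' : (openGraph ω).Reachable c a := (show (openGraph ω).Reachable a c from h).symm
      have hh : a = c ∨ ∃ e ∈ openEdgeCluster ω c, a ∈ e := (reachable_iff_exists_mem_openEdgeCluster ω c a).1 h'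
      rw [indicator_of_mem h, Pi.one_apply]
      simp only [hG1, if_pos hh]
    · have h' : ¬ (a = c ∨ ∃ e ∈ openEdgeCluster ω c, a ∈ e) := fun hh =>
        h (show (openGraph ω).Reachable a c from ((reachable_iff_exists_mem_openEdgeCluster ω c a).2 hh).symm)
      rw [indicator_of_notMem h]
      simp only [hG1, if_neg h']
  simp only [hG1ω] at hbhk
  rw [hDS] at hbhk
  -- (the avoided-set event is `(openConn b c)ᶜ`)
  -- rewrite the three integrals in hbhk
  have hI1 : ∫ ω in (openConn b c)ᶜ, (openConn a c : Set (BondConfig V)).indicator (1 : BondConfig V → ℝ) ω ∂μ = q := by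
    rw [setIntegral_indicator (hmeas _)]
    simp only [Pi.one_apply]
    rw [setIntegral_const, smul_eq_mul, mul_one, hq, hQ]
    congr 1
    ext ω
    simp only [mem_inter_iff, mem_compl_iff, mem_setOf_eq, openConn]
    constructor
    · rintro ⟨hbc', hac⟩
      exact ⟨hac, fun hab => hbc' (hab.symm.trans hac)⟩
    · rintro ⟨hac, hab⟩
      exact ⟨fun hbc' => hab (hac.trans hbc'.symm), hac⟩
  have hI2 : ∫ ω in (openConn b c)ᶜ, F (openCluster ω c) * (openConn a c : Set (BondConfig V)).indicator (1 : BondConfig V → ℝ) ω ∂μ =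
      ∫ ω in (openConn b c)ᶜ ∩ openConn a c, F (openCluster ω c) ∂μ :=
    setIntegral_mul_indicator_one μ _ _ _
  rw [hI1, hI2] at hbhk
  have hmS : μ.real (openConn b c : Set (BondConfig V))ᶜ = s := by rw [hs, hSS]
  rw [hmS] at hbhk
  -- hbhk : Cnb * q ≤ s * ∫_{(bc)ᶜ ∩ ac} F(C_c)
  -- (4) `∫_{(bc)ᶜ ∩ ac} F(C_c) ≤ Ana`: on `{a↔c}` the clusters of `a` and `c` agree, the set lies in `{a↮b}`, and `F ≥ 0`
  have hsub : (openConn b c : Set (BondConfig V))ᶜ ∩ openConn a c ⊆ (openConn a b)ᶜ := by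
    rintro ω ⟨hbc', hac⟩ hab
    exact hbc' ((show (openGraph ω).Reachable a b from hab).symm.trans hac)
  have h4 : ∫ ω in (openConn b c)ᶜ ∩ openConn a c, F (openCluster ω c) ∂μ ≤ Ana := by
    have e1 : ∫ ω in (openConn b c)ᶜ ∩ openConn a c, F (openCluster ω c) ∂μ =
        ∫ ω in (openConn b c)ᶜ ∩ openConn a c, F (openCluster ω a) ∂μ := by
      refine setIntegral_congr_fun (hmeas _) fun ω hω => ?_
      have h : (openGraph ω).Reachable a c := hω.2
      simp only [openCluster_eq_of_reachable h]
    rw [e1, hAna]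
    exact setIntegral_mono_set (Integrable.of_finite).integrableOn
      (Filter.Eventually.of_forall fun ω => hF0 _) (Filter.Eventually.of_forall hsub)
  -- (5) assemble
  have h5 : q * Cnb ≤ s * Ana := by
    have := mul_le_mul_of_nonneg_left h4 hs0
    linarith [hbhk]
  rw [hAsplit, hCsplit]
  nlinarith [hcore, h5, hs0, hq0]

end Q7Psi

end

end Summit.CriticalPhenomena.PercolationContinuityZ3.Theorems
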